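import Literature.NumberTheory.EllipticCurves.BSDQuadraticDescentShaOddPartGeneralProofs
import Literature.NumberTheory.EllipticCurves.BSDQuadraticDescent
import Literature.NumberTheory.EllipticCurves.BSDRootNumberSmallConductorProofs
import Literature.NumberTheory.EllipticCurves.BSDInvariantsProofs
import Literature.NumberTheory.EllipticCurves.HeegnerPoints
import Literature.NumberTheory.EllipticCurves.QuadraticTwist
import Literature.NumberTheory.QuadraticFields.SquareRootGenerator
import HarnessLib

/-!
# Route `RamifiedHeegnerPair`, crux X2 `RamifiedPairUpperBound` (stmt-BirchSwinnertonDyer-23192), line `birth`: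
# registered stub `stub_shaDescentOdd` — descent of the `3`-primary part of `Ш` from `K = ℚ(√d)` to the pair `(E, E^{(d)})`

For `W/ℚ` (elliptic), `d` a squarefree integer, `V` a `ℚ`-model of the twist `W^{(d)}`, and `K` an
imaginary quadratic field of discriminant `d` or `4d` (so `K = ℚ(√d)`), if `Ш(W/K)` is finite then
`Ш(W/ℚ)` and `Ш(V/ℚ)` are finite and
`ord₃ #Ш(W/ℚ) + ord₃ #Ш(V/ℚ) = ord₃ #Ш(W/K)[3^∞]` — in particular the registered inequality `≤`.
Pure bookkeeping over tree theorems: finiteness descends along restriction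
(`shaFinite_of_baseChange`, inflation–restriction) and to the twist
(`shaFinite_quadraticTwist_of_shaFinite_baseChange`), and the odd part of `Ш` under quadratic base
change multiplies, `#Ш(W/K)[p^∞] = #Ш(W)[p^∞] · #Ш(W^{(d_K)})[p^∞]` for odd `p`
(`WeierstrassCurve.card_primaryComponent_sha_baseChange_quadratic_of_odd_of_finite`,
Jetchev–Skinner–Wan 2017 §7.4.1 / Dokchitser–Dokchitser 2010 Lemma 4.14). The discriminant `4d` case
is reduced to `d` by `W^{(4d)} ≅ W^{(d)}` (`exists_variableChange_quadraticTwist_mul_sq`).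
Lead prover bsd-line-rhp-p2 g0, `--supports stmt-BirchSwinnertonDyer-23192`. No definition, no named
fact, no `sorry`. BSD is not proved by any of this.

References: [cite: JetchevSkinnerWan2017, §7.4.1 (arXiv:1512.06894 p. 30)]
[cite: DokchitserDokchitserAnnals2010, Lemma 4.14] [cite: SilvermanAEC2009, X.§4].
-/

set_option autoImplicit false
set_option linter.dupNamespace false

noncomputable section

open scoped Classical

namespace Summit.BirchSwinnertonDyer.BirchSwinnertonDyer.Theorems.RamifiedPairUpperBoundStubs

open WeierstrassCurve Literature.NumberTheory.EllipticCurves Literature.NumberTheory.QuadraticFields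

/-- A `ℚ`-model `V` of `W^{(d)}` is also a `ℚ`-model of `W^{(d_K)}` when `d_K ∈ {d, 4d}`
(`W^{(4d)} = W^{(d·2²)} ≅ W^{(d)}`). [folklore] -/
theorem exists_variableChange_twist_discr_of_discr_eq_or (W : WeierstrassCurve ℚ) (V : WeierstrassCurve ℚ)
    (d : ℤ) (K : Type) [Field K] [NumberField K]
    (hC : ∃ C : VariableChange ℚ, C • W.quadraticTwist (d : ℚ) = V)
    (hdisc : NumberField.discr K = d ∨ NumberField.discr K = 4 * d) :
    ∃ C : VariableChange ℚ, C • W.quadraticTwist (NumberField.discr K : ℚ) = V := by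
  obtain ⟨C, hC⟩ := hC
  rcases hdisc with h | h
  · exact ⟨C, by rw [h]; exact hC⟩
  · obtain ⟨C₁, hC₁⟩ := W.exists_variableChange_quadraticTwist_mul_sq (d : ℚ) 2 two_ne_zero
    have h4 : ((NumberField.discr K : ℤ) : ℚ) = (d : ℚ) * 2 ^ 2 := by rw [h]; push_cast; ring
    refine ⟨C * C₁⁻¹, ?_⟩
    rw [h4, ← hC₁, mul_smul, inv_smul_smul, hC]

/-- **Finiteness of `Ш` descends from `K = ℚ(√d)` to the pair `(W, V ≅ W^{(d)})`.** [folklore]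
[cite: SilvermanAEC2009, X.§4] -/
theorem shaFinite_pair_of_shaFinite_baseChange (W : WeierstrassCurve ℚ) [W.IsElliptic]
    (V : WeierstrassCurve ℚ) [V.IsElliptic] (d : ℤ) (K : Type) [Field K] [NumberField K]
    (hC : ∃ C : VariableChange ℚ, C • W.quadraticTwist (d : ℚ) = V)
    (hK : IsImaginaryQuadratic K)
    (hdisc : NumberField.discr K = d ∨ NumberField.discr K = 4 * d)
    (hfin : Finite (W.baseChange K).sha) : W.ShaFinite ∧ V.ShaFinite := by
  have h2 : Module.finrank ℚ K = 2 := hK.1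
  refine ⟨shaFinite_of_baseChange W K hfin, ?_⟩
  obtain ⟨θ, c, hθ, hc⟩ := Quadratic.exists_sq_eq_algebraMap (F := ℚ) (K := K) h2
  obtain ⟨q, hq, hd⟩ := NumberField.exists_discr_eq_mul_sq h2 hθ hc
  have hTw : (W.quadraticTwist c).ShaFinite :=
    shaFinite_quadraticTwist_of_shaFinite_baseChange W K hθ hc hfin
  obtain ⟨C₁, hC₁⟩ := W.exists_variableChange_quadraticTwist_mul_sq c q hq
  obtain ⟨C₂, hC₂⟩ := exists_variableChange_twist_discr_of_discr_eq_or W V d K hC hdisc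
  -- `V = C₂ • W^{(d_K)} = C₂ • C₁ • W^{(c)}`
  have hV : (C₂ * C₁) • W.quadraticTwist c = V := by rw [mul_smul, hC₁, ← hd, hC₂]
  rw [← hV]
  exact (shaFinite_variableChange_iff_holds (W.quadraticTwist c) (C₂ * C₁)).mpr hTw

/-- **The `3`-primary order of `Ш` over `K = ℚ(√d)` is the product of those of the pair**:
`ord₃ #Ш(W/ℚ) + ord₃ #Ш(V/ℚ) = ord₃ #Ш(W/K)[3^∞]` when `Ш(W/K)` is finite. [cite: JetchevSkinnerWan2017, §7.4.1] -/
theorem padicValNat_shaOrder_add_eq_of_shaFinite_baseChange (W : WeierstrassCurve ℚ) [W.IsElliptic]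
    (V : WeierstrassCurve ℚ) [V.IsElliptic] (d : ℤ) (K : Type) [Field K] [NumberField K]
    (hC : ∃ C : VariableChange ℚ, C • W.quadraticTwist (d : ℚ) = V)
    (hK : IsImaginaryQuadratic K)
    (hdisc : NumberField.discr K = d ∨ NumberField.discr K = 4 * d)
    (hfin : Finite (W.baseChange K).sha) :
    padicValNat 3 W.shaOrder + padicValNat 3 V.shaOrder =
      padicValNat 3 (Nat.card (AddCommGroup.primaryComponent (W.baseChange K).sha 3)) := by
  haveI : Fact (Nat.Prime 3) := ⟨Nat.prime_three⟩
  have h2 : Module.finrank ℚ K = 2 := hK.1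
  obtain ⟨hW, hV⟩ := shaFinite_pair_of_shaFinite_baseChange W V d K hC hK hdisc hfin
  haveI : Finite W.sha := hW
  haveI : Finite V.sha := hV
  haveI : (W.baseChange K).IsElliptic := by rw [baseChange]; infer_instance
  have hWd := exists_variableChange_twist_discr_of_discr_eq_or W V d K hC hdisc
  have hprod := W.card_primaryComponent_sha_baseChange_quadratic_of_odd_of_finite K h2 V hWd
    (W.baseChange K) ⟨1, one_smul _ _⟩ 3 (by norm_num)
  have h1 : Nat.card (AddCommGroup.primaryComponent W.sha 3) ≠ 0 := Nat.card_pos.ne'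
  have h2' : Nat.card (AddCommGroup.primaryComponent V.sha 3) ≠ 0 := Nat.card_pos.ne'
  rw [hprod, padicValNat.mul h1 h2', padicValNat_card_addPrimaryComponent (A := W.sha) 3,
    padicValNat_card_addPrimaryComponent (A := V.sha) 3]
  rfl

/-- **Registered stub `stub_shaDescentOdd` of line `birth` of crux X2 `RamifiedPairUpperBound`
(stmt-BirchSwinnertonDyer-23192), signature VERBATIM**: for `W`, `V` globally minimal elliptic over `ℚ`,
`d` squarefree and negative with `V ≅ W^{(d)}`, and `K` imaginary quadratic of discriminant `d` or `4d`
with `Ш(W/K)` finite, `ord₃ #Ш(W) + ord₃ #Ш(V) ≤ ord₃ #Ш(W/K)[3^∞]`. [cite: JetchevSkinnerWan2017, §7.4.1] -/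
theorem stub_shaDescentOdd :
    ∀ (W : WeierstrassCurve ℚ) [W.IsElliptic] [W.IsGloballyMinimal]
      (V : WeierstrassCurve ℚ) [V.IsElliptic] [V.IsGloballyMinimal] (d : ℤ)
      (K : Type) [Field K] [NumberField K],
      Squarefree d → d < 0 → (∃ C : WeierstrassCurve.VariableChange ℚ, C • W.quadraticTwist (d : ℚ) = V) →
      Literature.NumberTheory.EllipticCurves.IsImaginaryQuadratic K →
      (NumberField.discr K = d ∨ NumberField.discr K = 4 * d) →
      Finite (W.baseChange K).sha →
      padicValNat 3 W.shaOrder + padicValNat 3 V.shaOrder ≤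
        padicValNat 3 (Nat.card (AddCommGroup.primaryComponent (W.baseChange K).sha 3)) :=
  fun W _ _ V _ _ d K _ _ _ _ hC hK hdisc hfin ↦
    (padicValNat_shaOrder_add_eq_of_shaFinite_baseChange W V d K hC hK hdisc hfin).le

end Summit.BirchSwinnertonDyer.BirchSwinnertonDyer.Theorems.RamifiedPairUpperBoundStubs

end
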